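import Literature.MathematicalPhysics.QuantumFieldTheory.Balaban1983to89.B6Prop25OneLevelV1

/-!
# `Balaban1983to89.B6Prop25OneLevelFamG` — T. Bałaban, *Propagators and renormalization transformations for lattice gauge theories. II*,
# Commun. Math. Phys. **96** (1984) 223–250 [Balaban1984PropagatorsII], **Proposition 2.5** p. 246 — the VERBATIM typed statement
# `B6.Prop25Printed` INHABITED WITH NO HYPOTHESIS on the ONE-LEVEL sub-family of the local operators `G_□` of (2.90) (`Λ′ = ∅`), with the
# inequality half (1.110)–(1.114) of [4] Prop. 1.2 graded on [4]'s GENUINE torus family of record `B5Prop12GLattice.famG` — EVERY functional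
# of (1.110), (1.111), (1.112), (1.113), (1.114) the concrete quantity in `(Δ_a)⁻¹ = (DeltaA n M a)⁻¹` (r02's `B5SettingP12Real.latticeSettingP12R`)

statement-level skeleton of published theorems with citation tags; proofs where landed; nothing here is a claim about the Yang–Mills mass gap

PDF held: `paper:balaban1984-cmp96-propagators-rt-ii` (journal page = PDF page + 222), p. 246 [PDF 24]; `paper:balaban1984-cmp95-propagators-rt-i`
([4], journal page = PDF page + 16), pp. 35–36 [PDF 19–20].

PRINT (verbatim, p. 246): *"All the above considerations imply the following. Proposition 2.5. The operator G_□ defined by (2.90) on the torus T_□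
(or on the whole lattice ξZ^d) has the representation (2.129) and satisfies all the inequalities (1.110)–(1.114) of the Proposition 1.2 with a
positive constant δ₂ instead of δ₀. This constant depends on d and L only."*; p. 239: *"G_□ = (Δ − ∂P_□∂* + Q*aQ)⁻¹. (2.90)"*; p. 224: *"we admit
the case when some domains Ω_j are equal to T_η"*.  [4] = [Balaban1984PropagatorsI] Prop. 1.2 (1.110)–(1.114) pp. 35–36 (quoted verbatim in the
tree's `B5.Prop12Printed`).

CITATION HEADER (lean-in-tree rule) — WHAT IS REPRODUCED.  Phase-2 file of the `lit-balaban` typed skeleton (HOME `run/shared/lean/pub/lit-balaban/`),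
seat **r03 gen 14** (B6 fold owner; own lane, TAKING HOME/STATUS 2026-08-22T11:13:03Z); SKELETON row **B6.Prop2.5** (decl of record: the verbatim
census Prop `B6.Prop25Printed` over `B6.LocalOp`, b06 — untouched).  THE POINT OF THIS FILE (owner's fidelity repair of his own gen-10 file).
`B6Prop25OneLevelV1.prop25Printed_oneLevel` (p310856, the current head pid of row B6.Prop2.5) grades the [4]-half of Prop. 2.5 on p09's carrier
`BIJ85Ineq722ProofPart2.settingOf (torusRep P k (deltaAData _ a)) k`, via p19's `BIJ85Prop12AllTori.prop12Printed_allTori`.  That carrier was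
designed as a HYPOTHESIS carrier for [BalabanImbrieJaffe1985] (7.22): its functionals are GENUINE for (1.110) `m = 0, 1` (`|GJ|`, `|∇GJ|`) and
the first member of (1.111) (`‖ζ∇GJ‖_α`) ONLY — `l2Norm`, `holder`, `l2op`, `e 2`, `e 3`, `e4`, `h2`, `l2loc` are the constant `0` (p19's header
says so verbatim: «the other functionals of that carrier are `0`»; located for the B6 row by p22 gen 14, `lit-balaban-p22/GEN15-PLAN.md`).  Hence
p310856 certifies (1.110)₁,₂ and (1.111)₁ for `G_□ = Δ_a⁻¹` GENUINELY and (1.110)₃,₄, (1.111)₂, (1.112), (1.113), (1.114)₁₋₆ VACUOUSLY (`0 ≤ …`).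
THIS FILE re-bases the [4]-half on [4]'s family of record `B5Prop12GLattice.famG d L a` (r02/p37: `famG i = latticeSettingP12R (nP i.P) (MP i.P) a
i.P.K`, whose `e`, `h1`, `e4`, `h2`, `l2loc` are `B5Prop12FieldsLattice.eL/h1L/e4L/h2L/l2locL n M a` — the cube-sups, Hölder seminorms and cut
`L²` norms of `(DeltaA n M a)⁻¹ *ᵥ J`, `grad`/`Lap`/`divT` thereof, EVERY member concrete; Prop. 1.2 for it is the hypothesis-free
`B5Prop12GHolds.prop12_famG_printed` — row B5.Prop1.2, proved), the member of `famG` at the pair `(P, k)` being p19's reindexing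
`⟨d, L, m + K − k, k⟩` (`BIJ85Prop12AllTori.famG_reindex`, definitional: `latticeSettingP12R (L^k) (Mk P k) a k`).  The (2.129) half is UNCHANGED
(the `Repr2129` field of `locG i` IS the field of gen 10's `loc i`: p22's `B6Eq2129TwoScaleV1.eq2129_V1` for `oneLevelData P k a`).

WHAT IS PROVED (kernel-checked, 0 sorry, standard axioms; every `d`, `L`, `a > 0`; for `d = 0` or inadmissible `L` the index is empty).
* `locG_S` — the setting of `locG i` is `latticeSettingP12R (L^k) (Mk P k) a k` (`rfl`); `locG_repr_iff` — its `Repr2129` field is gen 10's.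
* `repr2129_locG` — (2.129) for every member (gen 10's `repr2129_loc`).
* `prop12Printed_locG` — the [4] half: `B5.Prop12Printed (fun i => (locG d L a i).S)` from `prop12_famG_printed`, constants chosen before `i`.
* **`prop25Printed_oneLevel_famG (d L) (ha : 0 < a) : B6.Prop25Printed (locG d L a)`** — NO HYPOTHESIS.
* HONESTY LINKS (the two conjuncts are about ONE operator): **`oneLevelData_G_apply_eq_re_inv_DeltaA`** — the operator `G` whose representation
  (2.129) is asserted in `locG i` acts by `(GJ)(b) = Re (((DeltaA (L^k) (Mk P k) a)⁻¹ *ᵥ J^c)(EK b₋, μ_b))` (gen 10's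
  `oneLevelData_G_apply_eq_sum_Gk` + p19's kernel dictionary `BIJ85Prop12BridgeSup.Gk_mulVec_apply`; `J^c = srcC J` the complexified source
  read through `EK`), i.e. THE matrix `(DeltaA (L^k) (Mk P k) a)⁻¹` on which every functional of `(locG i).S` is built; **`locG_e_zero_srcR`** —
  the (1.110)₁ functional graded IS `sup_{Δ̃(y)} |((DeltaA …)⁻¹ *ᵥ J^c)|`; **`abs_G_apply_le_locG_e_zero`** — so it DOMINATES `|(GJ)(b)|` at
  every bond `b` of `Δ̃(y)` (`|Re z| ≤ |z| ≤ sup`): the census bound (1.110)₁ of the second conjunct is a bound on the operator of the first.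
HONEST SCOPE.  ONE LEVEL ONLY, exactly as gen 10's file: the members of (2.90) with `Λ′ ≠ ∅` (the genuine two-scale operators — the content of
Sect. C beyond [4]) are NOT covered; for them (2.129) is p22's `eq2129_V1` (any `Λ′`) and the decay members are p22 g14/g15's
`B6Prop25DecayTwoScaleV1.prop25_ineq110_0` (|GJ|), `B6Prop25GradDecayTwoScaleV1.prop25_ineq110_grad` (|∇GJ|),
`B6Prop25L2LocTwoScaleV1.prop25_ineq114_0` (‖ζGJ‖), the rest in flight (p22/p38); no `B6.Prop25Printed` member with `Λ′ ≠ ∅` exists.  At one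
level `G_□ = Δ_a⁻¹` of [4] (1.69)–(1.71) and `δ₂ = δ₀` of [4] Prop. 1.2; the coarsest level `k = m + K` of each tower is excluded (p22's two-scale
structure needs the level `k + 1`); REAL sources: the (1.110)–(1.114) functionals of `famG` take [4]'s three source kinds (`LocR.vec/ten/ten2`)
complexified, and the link is stated for the vector kind through `srcC`/`srcR` (p19); (1.114) of `famG` is proved in the tree by a Combes–Thomas
route (`B5CombesThomasLattice`), not the printed random walk — declared in `B5Prop12GHolds`.  No new definition besides the reindexing `topOf` and
the family `locG` (bodies displayed); no hypothesis, no Prop-valued fact.  Value = the census Prop of Prop. 2.5 on the one-level sub-family with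
EVERY inequality slot a genuine functional of THE operator of (2.129) — the honest replacement of p310856 as the row's model instance; NOT summit
progress.  Unit `lit-balaban-r03` (gen 14), 2026-08-22.
-/

noncomputable section

open scoped BigOperators InnerProductSpace Matrix

namespace Literature.MathematicalPhysics.QuantumFieldTheory.Balaban1983to89.B6Prop25OneLevelFamG

open LatticeFieldCalculus B6SectCTwoScaleV1 B6SectCTwoScaleV1Lattice B6Prop25OneLevelV1
open B5Prop11Plancherel (Tor fine)
open B5DeltaA169 (DeltaA)
open B5Eq117TorusCarriers (Mk EK)
open B5Prop12FieldsLattice (cubeT cubeB eL supNormL)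
open B5SettingP12Real (LocR latticeSettingP12R)
open B5ResidualGpTorusHolds (TopIdx)
open B5Prop12GLattice (famG)
open B5Prop12GHolds (prop12_famG_printed)
open BalabanImbrieJaffe1984to88.BIJ85AxialPropagator411 (BondSpace)
open BalabanImbrieJaffe1984to88.BIJ85Ineq722DeltaA (Gk)
open BalabanImbrieJaffe1984to88.BIJ85Prop12BridgeSup (srcC srcR Gk_mulVec_apply emb_srcR)
open BalabanImbrieJaffe1984to88.BIJ85Prop12BridgeGeometry (EK_mem_cubeT_blk)
open B5Eq118OneStroke (iterBlockOf)

/-! ## §1  The reindexing into [4]'s torus family of record and the family `locG` -/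

/-- **the member of [4]'s torus family of record for the pair `(P, k)`**: the parameters `⟨d, L, m + K − k, k⟩` (volume `L^{m+K−k}` unit cubes per
direction at the unit lattice `T^{(k)}`, `η = L^{−k}`), p19's reindexing (`BIJ85Prop12AllTori.famG_reindex`).
[cite: Balaban1984PropagatorsI, Prop. 1.2 p.35 («for arbitrary T_η»), dictionary] -/
def topOf {d L : ℕ} (i : Idx d L) : TopIdx d L :=
  ⟨⟨i.1.1.d, i.1.1.L, i.1.1.m + i.1.1.K - i.1.2, i.1.2, i.1.1.hd, i.1.1.hL⟩, i.2.1, i.2.2.1, i.2.2.2.1⟩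

/-- **the one-level family of local operators `G_□` as `B6.LocalOp`s, [4]-half on the GENUINE family of record**: functionals
`S := famG d L a (topOf i)` (EVERY slot of (1.110)–(1.114) concrete in `(DeltaA (L^k) (Mk P k) a)⁻¹`), representation field := the (2.129)
identity for `oneLevelData` — verbatim the field of gen 10's `loc i`. [cite: Balaban1984PropagatorsII, Prop. 2.5 p.246] -/
def locG (d L : ℕ) (a : ℝ) (i : Idx d L) : B6.LocalOp where
  S := famG d L a (topOf i)
  Repr2129 := (loc d L a i).Repr2129

/-- **the setting of `locG i` IS r02's real weighted setting `latticeSettingP12R (L^k) (Mk P k) a k`** on the product torus of scale `k`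
(definitional: `nP ⟨d, L, m+K−k, k⟩ = L^k`, `MP … = Mk P k`, p19's `famG_reindex`). [cite: Balaban1984PropagatorsI, Prop. 1.2 p.35, dictionary] -/
theorem locG_S (d L : ℕ) (a : ℝ) (i : Idx d L) :
    (locG d L a i).S = latticeSettingP12R (i.1.1.L ^ i.1.2) (Mk i.1.1 i.1.2) a i.1.2 := rfl

/-- the representation field of `locG i` is the one of gen 10's `loc i` (same statement, same operator `oneLevelData P k a`).
[cite: Balaban1984PropagatorsII, (2.129) p.246, dictionary] -/
theorem locG_repr_iff (d L : ℕ) (a : ℝ) (i : Idx d L) : (locG d L a i).Repr2129 ↔ (loc d L a i).Repr2129 := Iff.rfl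

/-- **(2.129) holds for every member** (p22's `eq2129_V1` for `oneLevelData`, via gen 10's `repr2129_loc`). [cite: Balaban1984PropagatorsII, (2.129) p.246] -/
theorem repr2129_locG (d L : ℕ) {a : ℝ} (ha : 0 < a) (i : Idx d L) : (locG d L a i).Repr2129 :=
  repr2129_loc d L ha i

/-! ## §2  The [4] half on the genuine family and Proposition 2.5 -/

/-- **the [4] half of Prop. 2.5 for the one-level family, graded on the GENUINE functionals** — `B5Prop12GHolds.prop12_famG_printed` (Prop. 1.2 on
[4]'s torus family of record, ONE `(δ₀, O(1), O(1)(α), O(1)(ε), O(1)(α,ε))` chosen before the torus), reindexed along `topOf`; for `d = 0` or an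
inadmissible `L` the index `Idx d L` is empty and any positive constants do. [cite: Balaban1984PropagatorsII, Prop. 2.5 p.246; Balaban1984PropagatorsI, Prop. 1.2 pp.35–36] -/
theorem prop12Printed_locG (d L : ℕ) {a : ℝ} (ha : 0 < a) : B5.Prop12Printed (fun i : Idx d L => (locG d L a i).S) := by
  by_cases hne : Nonempty (Idx d L)
  · obtain ⟨i₀⟩ := hne
    have hd : 1 ≤ d := i₀.2.1 ▸ i₀.1.1.hd
    have hL : Odd L ∧ 1 < L := i₀.2.2.1 ▸ i₀.1.1.hL
    obtain ⟨δ₀, C, Cα, Cε, Cαε, hδ, hC, h⟩ := prop12_famG_printed hd hL ha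
    exact ⟨δ₀, C, Cα, Cε, Cαε, hδ, hC, fun i => h (topOf i)⟩
  · exact ⟨1, 1, fun _ => 1, fun _ => 1, fun _ _ => 1, one_pos, one_pos, fun i => (hne ⟨i⟩).elim⟩

/-- **PROPOSITION 2.5 ON THE ONE-LEVEL FAMILY, [4]-HALF GENUINE IN EVERY SLOT, NO HYPOTHESIS**: the verbatim census Prop `B6.Prop25Printed`
inhabited — (2.129) for every member (p22) ∧ the inequalities (1.110)–(1.114) of [4] Prop. 1.2 with one `(δ₂, O(1), O(1)(α), O(1)(ε), O(1)(α,ε))`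
for all members, graded on r02's real weighted setting of `(DeltaA (L^k) (Mk P k) a)⁻¹` (every functional concrete), both about ONE operator (§3).
[cite: Balaban1984PropagatorsII, Prop. 2.5 p.246] -/
theorem prop25Printed_oneLevel_famG (d L : ℕ) {a : ℝ} (ha : 0 < a) : B6.Prop25Printed (locG d L a) :=
  ⟨fun i => repr2129_locG d L ha i, prop12Printed_locG d L ha⟩

/-- the DAG edge of record `B6.prop12Shape_of_prop25` applied: the inequality half IS [4] Prop. 1.2 for the genuine settings.
[cite: Balaban1984PropagatorsII, Prop. 2.5 p.246] -/
theorem prop12_of_prop25_oneLevel_famG (d L : ℕ) {a : ℝ} (ha : 0 < a) : B5.Prop12Printed (fun i : Idx d L => (locG d L a i).S) :=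
  B6.prop12Shape_of_prop25 _ (prop25Printed_oneLevel_famG d L ha)

/-! ## §3  Honesty links: the functionals of `(locG i).S` grade THE operator of `(locG i).Repr2129` -/

/-- **HONESTY LINK — the operator of (2.129) IS the real part of r02's `(Δ_a)⁻¹ = (DeltaA (L^k) (Mk P k) a)⁻¹` read through `EK`**:
`(G J)(b) = Re (((DeltaA (L^k) (Mk P k) a)⁻¹ *ᵥ J^c)(EK b₋, μ_b))` with `J^c = srcC (J ∘ bondEquiv)` the complexified source of p19's bridge — THE
matrix on which every functional `eL/h1L/e4L/h2L/l2locL (L^k) (Mk P k) a` of `(locG i).S` is built (gen 10's `oneLevelData_G_apply_eq_sum_Gk` +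
p19's `Gk_mulVec_apply`). [cite: Balaban1984PropagatorsII, (2.90) p.239, Prop. 2.5 p.246; Balaban1984PropagatorsI, (1.71) p.30] -/
theorem oneLevelData_G_apply_eq_re_inv_DeltaA (P : Params) {k : ℕ} (hk : k + 1 ≤ P.m + P.K) {a : ℝ} (ha : 0 < a) (J : BondSpace P)
    (b : PBond P 0) :
    (oneLevelData P k a).G J b
      = (((DeltaA (P.L ^ k) (Mk P k) a)⁻¹ *ᵥ srcC (Nat.le_of_succ_le hk) (fun p : Site P 0 × Fin P.d => J ⟨p.1, p.2⟩))
          (EK (Nat.le_of_succ_le hk) b.src, b.dir)).re := by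
  rw [oneLevelData_G_apply_eq_sum_Gk P hk ha J b, ← Gk_mulVec_apply]
  simp only [Matrix.mulVec, dotProduct]
  exact (Fintype.sum_equiv (LatticeFieldCalculus.bondEquiv (P := P) (j := 0)) _ _ fun p => rfl).symm

/-- **the (1.110)₁ functional graded by the second conjunct IS the cube-sup of `|(Δ_a)⁻¹J^c|`**: for the real vector source `srcR J` (p19),
`(locG i).S.e 0 (srcR J) y = sup_{(z,ν) ∈ Δ̃(y) × directions} |((DeltaA (L^k) (Mk P k) a)⁻¹ *ᵥ srcC J)(z, ν)|` (r02's `eL … 0`, definitional).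
[cite: Balaban1984PropagatorsI, Prop. 1.2 (1.110) p.35; Balaban1984PropagatorsII, Prop. 2.5 p.246] -/
theorem locG_e_zero_srcR (d L : ℕ) (a : ℝ) (i : Idx d L) (J : Site i.1.1 0 × Fin i.1.1.d → ℝ) (y : Tor (Mk i.1.1 i.1.2)) :
    (locG d L a i).S.e 0 (srcR (Nat.le_of_succ_le i.2.2.2.2) J) y
      = LatticeNorms.supNorm (cubeB (i.1.1.L ^ i.1.2) (Mk i.1.1 i.1.2) y)
          ((DeltaA (i.1.1.L ^ i.1.2) (Mk i.1.1 i.1.2) a)⁻¹ *ᵥ srcC (Nat.le_of_succ_le i.2.2.2.2) J) := by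
  rfl

/-- **so the census bound (1.110)₁ of the second conjunct bounds THE operator of the first**: at every fine bond `b` whose initial point lies in the
unit cube of the `k`-block `b_k` (hence in `Δ̃(b_k)`), `|(G_□ J)(b)| ≤ (locG i).S.e 0 (srcR (J ∘ bondEquiv)) b_k` (`|Re z| ≤ |z| ≤ sup_{Δ̃}`).
[cite: Balaban1984PropagatorsII, Prop. 2.5 p.246; Balaban1984PropagatorsI, Prop. 1.2 (1.110) p.35] -/
theorem abs_G_apply_le_locG_e_zero (d L : ℕ) {a : ℝ} (ha : 0 < a) (i : Idx d L) (J : BondSpace i.1.1) (b : PBond i.1.1 0) :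
    |(oneLevelData i.1.1 i.1.2 a).G J b|
      ≤ (locG d L a i).S.e 0 (srcR (Nat.le_of_succ_le i.2.2.2.2) (fun p : Site i.1.1 0 × Fin i.1.1.d => J ⟨p.1, p.2⟩))
          (iterBlockOf i.1.2 b.src) := by
  rw [locG_e_zero_srcR, oneLevelData_G_apply_eq_re_inv_DeltaA i.1.1 i.2.2.2.2 ha J b]
  refine (Complex.abs_re_le_norm _).trans ?_
  refine LatticeNorms.norm_le_supNorm _ ?_
  exact Finset.mem_product.2 ⟨EK_mem_cubeT_blk (Nat.le_of_succ_le i.2.2.2.2) b.src, Finset.mem_univ _⟩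

/-- non-vacuity of the index (gen 10's `idx_nonempty`): any `P : Params` with `m + K ≥ 2` gives a member at level `1`.
[cite: Balaban1984PropagatorsII, Prop. 2.5 p.246] -/
theorem idx_nonempty' (P : Params) (h : 2 ≤ P.m + P.K) : Nonempty (Idx P.d P.L) := idx_nonempty P h

end Literature.MathematicalPhysics.QuantumFieldTheory.Balaban1983to89.B6Prop25OneLevelFamG

end
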